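import Summits.ResolutionOfSingularities.ResolutionOfSingularities.Theorems.FrobeniusLadderFInjectiveMacaulayficationTauFloorOneCIChartCore
import Summits.ResolutionOfSingularities.ResolutionOfSingularities.Theorems.FrobeniusLadderFInjectiveMacaulayficationCIInBadBoundary
import Summits.ResolutionOfSingularities.ResolutionOfSingularities.Theorems.FrobeniusLadderFInjectiveMacaulayficationGermOfGlobalBlowup
import HarnessLib

/-!
# F4POS-1 (c) (ii′): the CI chart `D(y)` of `Bl_τ(P2d4C)` is COHEN–MACAULAY at every point
# (crux `FInjectiveMacaulayfication` stmt-ResolutionOfSingularities-15315, chain w45a; res-L1-w45a-plan-1 RULING R18.10 «(ii′) S′ is CM at those charts (CI) —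
# the admissibility/CM half of the F4POS input»; seat res-L1-w45a-stub-1 g10)

[OURS · L1 W4.5a] Support file (`--supports stmt-ResolutionOfSingularities-15315 --as helper`); def-free, unconditional, ANY field `k`; replaces the
role of NO printed item; NOT a statement of the manuscript; AI-written (AI review is weaker than expert review).

`C = k[X₀..X₅]/(g₁, g₂)`, `g₁ = x² − wy`, `g₂ = z′² + y(1 + w²z′ + u′³ + t′³)` (`…TauFloorOneCIChartCore`). For a prime `Q` of `C` over `P ⊂ k[X]`:
`k[X]_P` is a regular local ring; `g₁ ≠ 0` gives the CM clause for `k[X]_P/(g₁)` (`Fedder.sop_isWeaklyRegular_quotient`); `(g₁)k[X]_P` is prime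
(`g₁` prime, `prime_g₁`) and `g₂ ∉ (g₁)` (`g₂(0,…,0,1) = 1`), so `g₂` is regular on `k[X]_P/(g₁)` and the CM clause descends once more
(`CIInBadBoundary.cmCl_quotient`); finally `k[X]_P/(g₁, g₂) ≅ C_Q` (localisation commutes with quotients, §1). Results:
★ `cmCl_localization` (`CMCl (C_Q)` for every prime `Q`), ★ `cmCl_stalk` (`CMCl 𝒪_{Spec C, w}` for every point `w`).
[folklore: complete intersections in regular local rings are Cohen–Macaulay; cite: Matsumura1987, Thm. 17.4 (iii)]
-/

-- single-problem summit: the doubled namespace component is forced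
set_option linter.dupNamespace false

noncomputable section

open AlgebraicGeometry IsLocalRing RingTheory.Sequence Literature.AlgebraicGeometry.Resolution MvPolynomial
open scoped Pointwise

namespace Summit.ResolutionOfSingularities.ResolutionOfSingularities.Theorems.FInjectiveMacaulayfication.TauFloorOneCIChartCM

open Summit.ResolutionOfSingularities.ResolutionOfSingularities.Theorems.FInjectiveMacaulayfication
open SliceableCentre TauFloorOneCIChartCore

/-! ## §1 Localisation commutes with quotients (ideal form) -/

/-- **`A_P ⧸ I·A_P ≃+* (A/I)_Q`** for a prime `Q` of `A ⧸ I` lying over `P` (`Q.comap mk = P`): the ideal form of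
`QuotLocalizationIso.stub_quotLocalizationIso`. [folklore; cite: StacksProject, Tag 00CT] -/
theorem exists_quotLocalizationEquiv {A : Type} [CommRing A] (I : Ideal A) (Q : Ideal (A ⧸ I)) [Q.IsPrime] :
    Nonempty ((Localization.AtPrime (Q.comap (Ideal.Quotient.mk I)) ⧸
      I.map (algebraMap A (Localization.AtPrime (Q.comap (Ideal.Quotient.mk I))))) ≃+* Localization.AtPrime Q) := by
  have hL : IsLocalization Q.primeCompl (Localization.AtPrime (Q.comap (Ideal.Quotient.mk I)) ⧸
      I.map (algebraMap A (Localization.AtPrime (Q.comap (Ideal.Quotient.mk I))))) := by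
    rw [← QuotLocalizationIso.algebraMapSubmonoid_primeCompl_comap I Q]
    infer_instance
  exact ⟨(IsLocalization.algEquiv Q.primeCompl (Localization.AtPrime (Q.comap (Ideal.Quotient.mk I)) ⧸
    I.map (algebraMap A (Localization.AtPrime (Q.comap (Ideal.Quotient.mk I))))) (Localization.AtPrime Q)).toRingEquiv⟩

/-- **CM descends along a length-2 weakly regular sequence** `(a, b)` in the maximal ideal of a Noetherian local ring `R`, given the CM clause for
`R/(a)`: `R/(a, b)` satisfies the CM clause (`CIInBadBoundary.cmCl_quotient` + the third isomorphism theorem). [cite: Matsumura1987, Thm. 17.4 (iii)] -/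
theorem cmCl_quotient_pair {R : Type} [CommRing R] [IsNoetherianRing R] [IsLocalRing R] (a b : R) (ha : a ∈ maximalIdeal R)
    (hb : b ∈ maximalIdeal R) (hCMa : CMCl (R ⧸ Ideal.span {a})) (hreg : IsSMulRegular (QuotSMulTop a R) b) :
    CMCl (R ⧸ Ideal.span {a, b}) := by
  obtain ⟨hnt, hloc⟩ := isLocalRing_quotient_span_singleton ha
  have hmem' : ∀ x ∈ [b], x ∈ maximalIdeal R := fun x hx => by
    rw [List.mem_singleton] at hx; rw [hx]; exact hb
  have hwreg : IsWeaklyRegular (QuotSMulTop a R) [b] := (isWeaklyRegular_cons_iff _ _ _).mpr ⟨hreg, IsWeaklyRegular.nil _ _⟩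
  haveI : Nontrivial (QuotSMulTop a R) := nontrivial_quotSMulTop_of_mem_maximalIdeal R ha
  have hreg'' : IsRegular (QuotSMulTop a R) [b] := IsRegular.of_isWeaklyRegular_of_mem_maximalIdeal _ hmem' hwreg
  obtain ⟨hmem₂, hreg₂⟩ := isRegular_quotient_of_isRegular_quotSMulTop ha hreg'' hmem'
  have hbm : Ideal.Quotient.mk (Ideal.span {a}) b ∈ maximalIdeal (R ⧸ Ideal.span {a}) := hmem₂ _ (by simp)
  have hbreg : IsSMulRegular (R ⧸ Ideal.span {a}) (Ideal.Quotient.mk (Ideal.span {a}) b) := by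
    have := hreg₂.toIsWeaklyRegular
    rw [List.map_singleton, isWeaklyRegular_cons_iff] at this
    exact this.1
  have hCM2 := CIInBadBoundary.cmCl_quotient hCMa hbm hbreg
  have h1 : Ideal.span {Ideal.Quotient.mk (Ideal.span {a}) b} = (Ideal.span {b}).map (Ideal.Quotient.mk (Ideal.span {a})) := by
    rw [Ideal.map_span, Set.image_singleton]
  have h2 : Ideal.span {a} ⊔ Ideal.span {b} = Ideal.span {a, b} := (Ideal.span_insert a {b}).symm
  exact FiLocusOpenOfAffine.cmClause_of_ringEquiv
    ((Ideal.quotEquivOfEq h1).trans ((DoubleQuot.quotQuotEquivQuotSup (Ideal.span {a}) (Ideal.span {b})).trans (Ideal.quotEquivOfEq h2))) hCM2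

/-! ## §2 `g₁` is prime in `k[X₀..X₅]` and does not divide `g₂` -/

variable (k : Type) [Field k]

/-- `g₁ = x² − wy` is prime in `k[X₀..X₅]` (the six-variable twin of `TauFloorOneCIChartCore.prime_g₁'`). [folklore] -/
theorem prime_g₁ (g₁ : MvPolynomial (Fin 6) k) (hg₁ : g₁ = X 0 ^ 2 - X 2 * X 1) : Prime g₁ := by
  set e : MvPolynomial (Fin 6) k ≃+* Polynomial (MvPolynomial (Fin 5) k) := (finSuccEquiv k 5).toRingEquiv with he_def
  have he0 : e (X 0) = Polynomial.X := finSuccEquiv_X_zero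
  have hej : ∀ j : Fin 5, e (X j.succ) = Polynomial.C (X j) := fun j => finSuccEquiv_X_succ (j := j)
  set c : MvPolynomial (Fin 5) k := -(X 1 * X 0) with hc
  have heg : e g₁ = Polynomial.X ^ 2 + Polynomial.C (0 : MvPolynomial (Fin 5) k) * Polynomial.X + Polynomial.C c := by
    rw [hg₁, map_sub, map_pow, map_mul, he0, show (2 : Fin 6) = (1 : Fin 5).succ from rfl, show (1 : Fin 6) = (0 : Fin 5).succ from rfl,
      hej, hej, hc]
    simp only [map_zero, zero_mul, add_zero, map_neg, map_mul]
    ring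
  set a : Fin 5 → k := ![1, 0, 0, 0, 0] with ha
  have hba : MvPolynomial.eval a (0 : MvPolynomial (Fin 5) k) = 0 := map_zero _
  have hca : MvPolynomial.eval a c = 0 := by rw [hc]; simp [ha]
  have hder : MvPolynomial.eval a (pderiv 1 c) ≠ 0 := by
    have e1 : pderiv 1 c = -X 0 := by
      rw [hc, map_neg, (pderiv 1).leibniz, pderiv_X_self, pderiv_X_of_ne (show (0 : Fin 5) ≠ 1 by decide)]
      simp
    rw [e1, map_neg, eval_X, ha]
    simp
  have hirr : Irreducible (e g₁) := by
    rw [heg]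
    exact Literature.AlgebraicGeometry.Motives.SmoothHypersurface.irreducible_X_pow_add_C_mul_X_add_C (d := 2) le_rfl 0 c a hba hca 1 hder
  exact (MulEquiv.prime_iff e).mp hirr.prime

/-- `g₁ ∤ g₂` (evaluate at `(0,0,0,0,0,1)`: `g₁ ↦ 0`, `g₂ ↦ 1`). [folklore] -/
theorem not_dvd_g₂ (g₁ g₂ : MvPolynomial (Fin 6) k) (hg₁ : g₁ = X 0 ^ 2 - X 2 * X 1)
    (hg₂ : g₂ = X 5 ^ 2 + X 1 * (1 + X 2 ^ 2 * X 5 + X 3 ^ 3 + X 4 ^ 3)) : ¬ g₁ ∣ g₂ := by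
  rintro ⟨q, hq⟩
  have h := congrArg (MvPolynomial.eval (Pi.single 5 1 : Fin 6 → k)) hq
  rw [map_mul, hg₁, hg₂] at h
  simp at h

/-! ## §3 The CM clause at every point of the CI chart -/

set_option maxHeartbeats 800000 in
-- two quotient steps in `k[X]_P` + the quotient/localisation transport
/-- ★ **`C_Q` satisfies the CM clause for every prime `Q` of `C = k[X₀..X₅]/(x² − wy, z′² + y(1 + w²z′ + u′³ + t′³))`** (any field `k`):
`k[X]_P` regular ⇒ `k[X]_P/(g₁)` CM (`g₁ ≠ 0`) ⇒ `k[X]_P/(g₁, g₂)` CM (`g₂` regular modulo the prime `(g₁)k[X]_P`) `≅ C_Q`.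
[folklore; cite: Matsumura1987, Thm. 17.4 (iii)] -/
theorem cmCl_localization (g₁ g₂ : MvPolynomial (Fin 6) k) (hg₁ : g₁ = X 0 ^ 2 - X 2 * X 1)
    (hg₂ : g₂ = X 5 ^ 2 + X 1 * (1 + X 2 ^ 2 * X 5 + X 3 ^ 3 + X 4 ^ 3))
    (Q : Ideal (MvPolynomial (Fin 6) k ⧸ Ideal.span {g₁, g₂})) [Q.IsPrime] : CMCl (Localization.AtPrime Q) := by
  classical
  set P : Ideal (MvPolynomial (Fin 6) k) := Q.comap (Ideal.Quotient.mk (Ideal.span {g₁, g₂})) with hPdef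
  set Rp := Localization.AtPrime P with hRp
  set alg : MvPolynomial (Fin 6) k →+* Rp := algebraMap (MvPolynomial (Fin 6) k) Rp with halg
  haveI : IsRegularLocalRing Rp := IsRegularRing.isRegularLocalRing_localization P
  haveI : IsDomain Rp := isDomain_of_isRegularLocalRing Rp
  have hinj : Function.Injective alg := IsLocalization.injective Rp P.primeCompl_le_nonZeroDivisors
  -- `g₁, g₂ ∈ P`
  have hgI : g₁ ∈ Ideal.span {g₁, g₂} ∧ g₂ ∈ Ideal.span {g₁, g₂} := ⟨Ideal.subset_span (Or.inl rfl), Ideal.subset_span (Or.inr rfl)⟩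
  have hg₁P : g₁ ∈ P := by
    rw [hPdef, Ideal.mem_comap, Ideal.Quotient.eq_zero_iff_mem.mpr hgI.1]; exact Q.zero_mem
  have hg₂P : g₂ ∈ P := by
    rw [hPdef, Ideal.mem_comap, Ideal.Quotient.eq_zero_iff_mem.mpr hgI.2]; exact Q.zero_mem
  have hmax : maximalIdeal Rp = P.map alg := (Localization.AtPrime.map_eq_maximalIdeal (I := P)).symm
  have ha₁m : alg g₁ ∈ maximalIdeal Rp := by rw [hmax]; exact Ideal.mem_map_of_mem _ hg₁P
  have ha₂m : alg g₂ ∈ maximalIdeal Rp := by rw [hmax]; exact Ideal.mem_map_of_mem _ hg₂P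
  have ha₁0 : alg g₁ ≠ 0 := fun h => (prime_g₁ k g₁ hg₁).ne_zero (hinj (by rw [h, map_zero]))
  -- STEP 1: `Rp/(g₁)` is CM
  have hCM1 : CMCl (Rp ⧸ Ideal.span {alg g₁}) := fun d hd s hs => Fedder.sop_isWeaklyRegular_quotient ha₁m ha₁0 d hd s hs
  -- STEP 2: `g₂` is regular on `Rp/(g₁)`: `(g₁)Rp` is prime and does not contain `g₂`
  have hdisj : Disjoint (P.primeCompl : Set (MvPolynomial (Fin 6) k)) (Ideal.span {g₁} : Ideal (MvPolynomial (Fin 6) k)) := by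
    refine Set.disjoint_left.mpr fun x hx hxI => hx ?_
    exact (Ideal.span_singleton_le_iff_mem _ |>.mpr hg₁P) hxI
  have hprime1 : (Ideal.span {alg g₁} : Ideal Rp).IsPrime := by
    have h := IsLocalization.isPrime_of_isPrime_disjoint P.primeCompl Rp (Ideal.span {g₁})
      ((Ideal.span_singleton_prime (prime_g₁ k g₁ hg₁).ne_zero).mpr (prime_g₁ k g₁ hg₁)) hdisj
    rwa [Ideal.map_span, Set.image_singleton] at h
  have ha₂not : alg g₂ ∉ (Ideal.span {alg g₁} : Ideal Rp) := by
    intro hmem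
    have hcomap := IsLocalization.under_map_of_isPrime_disjoint P.primeCompl Rp
      ((Ideal.span_singleton_prime (prime_g₁ k g₁ hg₁).ne_zero).mpr (prime_g₁ k g₁ hg₁)) hdisj
    have : g₂ ∈ (Ideal.map alg (Ideal.span {g₁})).under (MvPolynomial (Fin 6) k) := by
      rw [Ideal.under_def, Ideal.mem_comap, Ideal.map_span, Set.image_singleton]; exact hmem
    rw [hcomap, Ideal.mem_span_singleton] at this
    exact not_dvd_g₂ k g₁ g₂ hg₁ hg₂ this
  have hcolon : ∀ v : Rp, v * alg g₂ ∈ (Ideal.span {alg g₁} : Ideal Rp) → v ∈ (Ideal.span {alg g₁} : Ideal Rp) :=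
    fun v hv => ((hprime1.mem_or_mem hv).resolve_right ha₂not)
  have hreg2 : IsSMulRegular (QuotSMulTop (alg g₁) Rp) (alg g₂) := by
    have heq : ((alg g₁) • (⊤ : Submodule Rp Rp)) = (Ideal.span {alg g₁} : Ideal Rp) := by
      rw [← Submodule.ideal_span_singleton_smul, smul_eq_mul, Ideal.mul_top]
    change IsSMulRegular (Rp ⧸ ((alg g₁) • (⊤ : Submodule Rp Rp))) (alg g₂)
    rw [heq]
    intro b c hbc
    obtain ⟨b, rfl⟩ := Ideal.Quotient.mk_surjective b
    obtain ⟨c, rfl⟩ := Ideal.Quotient.mk_surjective c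
    have hbc' : Ideal.Quotient.mk (Ideal.span {alg g₁}) (alg g₂ * b) = Ideal.Quotient.mk (Ideal.span {alg g₁}) (alg g₂ * c) := by
      change Ideal.Quotient.mk (Ideal.span {alg g₁}) (alg g₂ • b) = Ideal.Quotient.mk (Ideal.span {alg g₁}) (alg g₂ • c) at hbc
      simpa only [smul_eq_mul] using hbc
    rw [Ideal.Quotient.eq] at hbc' ⊢
    rw [← mul_sub] at hbc'
    exact hcolon _ (by rw [mul_comm]; exact hbc')
  -- STEP 3: `Rp/(g₁, g₂)` is CM; STEP 4: transport to `C_Q`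
  have hCM2 : CMCl (Rp ⧸ Ideal.span {alg g₁, alg g₂}) := cmCl_quotient_pair (alg g₁) (alg g₂) ha₁m ha₂m hCM1 hreg2
  have h2 : (Ideal.span {alg g₁, alg g₂} : Ideal Rp) = (Ideal.span {g₁, g₂}).map alg := by
    rw [Ideal.map_span alg {g₁, g₂}, Set.image_pair]
  obtain ⟨eI⟩ := exists_quotLocalizationEquiv (Ideal.span {g₁, g₂}) Q
  exact FiLocusOpenOfAffine.cmClause_of_ringEquiv ((Ideal.quotEquivOfEq h2).trans eI) hCM2

/-- ★ **The CI chart is Cohen–Macaulay at every point of `Spec C`** (stalk form). [folklore] -/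
theorem cmCl_stalk (g₁ g₂ : MvPolynomial (Fin 6) k) (hg₁ : g₁ = X 0 ^ 2 - X 2 * X 1)
    (hg₂ : g₂ = X 5 ^ 2 + X 1 * (1 + X 2 ^ 2 * X 5 + X 3 ^ 3 + X 4 ^ 3))
    (w : Spec (.of (MvPolynomial (Fin 6) k ⧸ Ideal.span {g₁, g₂}))) :
    CMCl ((Spec (.of (MvPolynomial (Fin 6) k ⧸ Ideal.span {g₁, g₂}))).presheaf.stalk w) :=
  GermOfGlobalBlowup.cmCl_stalk_Spec_of_cmCl_localization w (cmCl_localization k g₁ g₂ hg₁ hg₂ w.asIdeal)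

end Summit.ResolutionOfSingularities.ResolutionOfSingularities.Theorems.FInjectiveMacaulayfication.TauFloorOneCIChartCM

end
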